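import Mathlib.MeasureTheory.Integral.Bochner.Set
import Mathlib.MeasureTheory.Integral.Prod
import Mathlib.MeasureTheory.Measure.Lebesgue.Integral
import Mathlib.MeasureTheory.Group.Integral
import Mathlib.MeasureTheory.Measure.Haar.NormedSpace
import Mathlib.Analysis.SpecialFunctions.Integrals.Basic
import Mathlib.MeasureTheory.Integral.IntervalIntegral.Basic
import HarnessLib

/-!
# One-sided convolution on `(0, ∞)`

The convolution algebra of locally bounded measurable functions on the half-line,

  `(f ⋆ g)(x) = ∫_{0 < t ≤ x} f(t) g(x − t) dt`     (`oconv f g x`; `= 0` for `x ≤ 0`),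

developed from scratch (everything PROVED): a commutative, associative, bilinear product whose
value at `x` only involves `f, g` on `[0, x]` (locality), on which multiplication by the variable
`D f(t) = t f(t)` acts as a derivation, with the Young-type bounds. This is the one-variable
calculus behind iterated "slice integrals" `∫_{u₁+⋯+u_d = w} φ(u₁)⋯φ(u_d)` (the `d`-fold
convolution power of `φ`), used for Ford–Maynard's modified Liouville functions
(`Literature/NumberTheory/Sieve/FordMaynard*.lean`); powers and their expansions are in
`OneSidedConvolutionPowers.lean`.

* `oconv`, `LocBdd` (measurable, bounded on every `[-A, A]`; closed under `+`, scalars, products,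
  indicators, `D`, and `⋆`: `LocBdd.oconv`);
* `oconv_comm`, `oconv_assoc` (Fubini on the triangle `setIntegral_triangle_swap` + translation
  `setIntegral_Ioc_comp_sub`), `oconv_add_left/right`, `oconv_const_mul_left/right`,
  `oconv_sum_left/right`, `oconv_zero_left/right`;
* locality `oconv_congr_of_eqOn`; supports `oconv_eq_zero_of_lt` (lower supports add) and
  `oconv_eq_zero_of_le` (upper supports add); the derivation rule `id_mul_oconv`:
  `x (f ⋆ g)(x) = (Df ⋆ g)(x) + (f ⋆ Dg)(x)`;
* `setIntegral_oconv`: `∫_0^X (g ⋆ h) = ∫_0^X g(t) ∫_0^{X−t} h`; positivity and monotonicity;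
  Young `oconv_le_mul_setIntegral` (`sup × L¹`) and `setIntegral_oconv_le` (`L¹ × L¹`, `≥ 0`).

Mathlib (pinned) has the two-sided convolution `MeasureTheory.convolution` on groups (with
`convolution_assoc` under global integrability hypotheses); the half-line algebra with merely
locally bounded factors (e.g. `t ↦ 𝟙_{t ≥ η}/t`, not integrable on `ℝ`) is set up directly on
set integrals over `Ioc 0 x`, which is what the applications evaluate.
-/

noncomputable section

open MeasureTheory Set Finset

namespace Literature.Analysis.Convolution

/-- The one-sided convolution `(f ⋆ g)(x) = ∫_{0 < t ≤ x} f(t) g(x − t) dt` (`= 0` for `x ≤ 0`).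
[folklore] -/
def oconv (f g : ℝ → ℝ) (x : ℝ) : ℝ := ∫ t in Set.Ioc 0 x, f t * g (x - t)

/-- Locally bounded measurable functions: measurable and bounded on every `[-A, A]`.
[folklore] -/
structure LocBdd (f : ℝ → ℝ) : Prop where
  measurable : Measurable f
  bdd : ∀ A : ℝ, ∃ C : ℝ, ∀ t, |t| ≤ A → |f t| ≤ C

namespace LocBdd

variable {f g : ℝ → ℝ}

/-- A non-negative local bound. [folklore] -/
theorem bdd_nonneg (hf : LocBdd f) (A : ℝ) : ∃ C : ℝ, 0 ≤ C ∧ ∀ t, |t| ≤ A → |f t| ≤ C := by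
  obtain ⟨C, hC⟩ := hf.bdd A
  exact ⟨max C 0, le_max_right _ _, fun t ht => (hC t ht).trans (le_max_left _ _)⟩

/-- Sums. [folklore] -/
theorem add (hf : LocBdd f) (hg : LocBdd g) : LocBdd (fun t => f t + g t) := by
  refine ⟨hf.measurable.add hg.measurable, fun A => ?_⟩
  obtain ⟨C, hC⟩ := hf.bdd A
  obtain ⟨D, hD⟩ := hg.bdd A
  exact ⟨C + D, fun t ht => (abs_add_le _ _).trans (add_le_add (hC t ht) (hD t ht))⟩

/-- Scalar multiples. [folklore] -/
theorem const_mul (hf : LocBdd f) (c : ℝ) : LocBdd (fun t => c * f t) := by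
  refine ⟨hf.measurable.const_mul c, fun A => ?_⟩
  obtain ⟨C, hC⟩ := hf.bdd A
  exact ⟨|c| * C, fun t ht => by
    rw [abs_mul]; exact mul_le_mul_of_nonneg_left (hC t ht) (abs_nonneg c)⟩

/-- Negation. [folklore] -/
theorem neg (hf : LocBdd f) : LocBdd (fun t => -f t) := by
  simpa using hf.const_mul (-1)

/-- Differences. [folklore] -/
theorem sub (hf : LocBdd f) (hg : LocBdd g) : LocBdd (fun t => f t - g t) := by
  simpa [sub_eq_add_neg] using hf.add hg.neg

/-- The zero function. [folklore] -/
theorem zero : LocBdd (fun _ => (0 : ℝ)) :=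
  ⟨measurable_const, fun _ => ⟨0, fun _ _ => by simp⟩⟩

/-- Constants. [folklore] -/
theorem const (c : ℝ) : LocBdd (fun _ => c) :=
  ⟨measurable_const, fun _ => ⟨|c|, fun _ _ => le_rfl⟩⟩

/-- Finite sums of locally bounded measurable functions. [folklore] -/
theorem sum {ι : Type*} (s : Finset ι) {F : ι → ℝ → ℝ} (hF : ∀ i ∈ s, LocBdd (F i)) :
    LocBdd (fun t => ∑ i ∈ s, F i t) := by
  classical
  induction s using Finset.induction_on with
  | empty => simpa using LocBdd.zero
  | insert b s hb ih =>
    have h1 : LocBdd (F b) := hF b (Finset.mem_insert_self b s)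
    have h2 := ih (fun i hi => hF i (Finset.mem_insert_of_mem hi))
    simpa [Finset.sum_insert hb] using h1.add h2

/-- Pointwise products. [folklore] -/
theorem mul (hf : LocBdd f) (hg : LocBdd g) : LocBdd (fun t => f t * g t) := by
  refine ⟨hf.measurable.mul hg.measurable, fun A => ?_⟩
  obtain ⟨C, hC0, hC⟩ := hf.bdd_nonneg A
  obtain ⟨D, hD⟩ := hg.bdd A
  exact ⟨C * D, fun t ht => by
    rw [abs_mul]; exact mul_le_mul (hC t ht) (hD t ht) (abs_nonneg _) hC0⟩

/-- Multiplication by the variable (the derivation `D`). [folklore] -/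
theorem id_mul (hf : LocBdd f) : LocBdd (fun t => t * f t) :=
  LocBdd.mul ⟨measurable_id, fun A => ⟨A, fun _ ht => ht⟩⟩ hf

/-- The indicator of a measurable set times a locally bounded function. [folklore] -/
theorem indicator (hf : LocBdd f) {s : Set ℝ} (hs : MeasurableSet s) :
    LocBdd (s.indicator f) := by
  refine ⟨hf.measurable.indicator hs, fun A => ?_⟩
  obtain ⟨C, hC0, hC⟩ := hf.bdd_nonneg A
  refine ⟨C, fun t ht => ?_⟩
  by_cases h : t ∈ s
  · rw [Set.indicator_of_mem h]; exact hC t ht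
  · rw [Set.indicator_of_notMem h, abs_zero]; exact hC0

/-- A locally bounded measurable function is integrable on every `(a, b]`. [folklore] -/
theorem integrableOn_Ioc (hf : LocBdd f) (a b : ℝ) : IntegrableOn f (Set.Ioc a b) := by
  obtain ⟨C, hC⟩ := hf.bdd (max |a| |b|)
  refine Measure.integrableOn_of_bounded (M := C) measure_Ioc_lt_top.ne
    hf.measurable.aestronglyMeasurable ?_
  refine (ae_restrict_iff' measurableSet_Ioc).2 (Filter.Eventually.of_forall fun t ht => ?_)
  rw [Real.norm_eq_abs]
  refine hC t (abs_le.2 ⟨?_, ?_⟩)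
  · have : -|a| ≤ a := neg_abs_le a
    linarith [ht.1, le_max_left |a| |b|]
  · exact le_trans (le_trans ht.2 (le_abs_self b)) (le_max_right _ _)

end LocBdd

/-! ### Basic properties of the one-sided convolution -/

section Basic

variable {f g h : ℝ → ℝ}

/-- `(f ⋆ g)(x) = 0` for `x ≤ 0`. [folklore] -/
theorem oconv_of_nonpos {x : ℝ} (hx : x ≤ 0) (f g : ℝ → ℝ) : oconv f g x = 0 := by
  rw [oconv, Set.Ioc_eq_empty (not_lt.2 hx), Measure.restrict_empty, integral_zero_measure]

/-- The convolution as an integral over `ℝ` of an indicator. [folklore] -/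
theorem oconv_eq_integral_indicator (f g : ℝ → ℝ) (x : ℝ) :
    oconv f g x = ∫ t, (Set.Ioc 0 x).indicator (fun t => f t * g (x - t)) t := by
  rw [oconv, integral_indicator measurableSet_Ioc]

/-- **Commutativity**: `f ⋆ g = g ⋆ f`. [folklore] -/
theorem oconv_comm (f g : ℝ → ℝ) : oconv f g = oconv g f := by
  funext x
  rw [oconv_eq_integral_indicator, oconv_eq_integral_indicator,
    ← integral_sub_left_eq_self _ volume x]
  refine integral_congr_ae ?_
  have hae : ∀ᵐ t ∂(volume : Measure ℝ), t ≠ 0 ∧ t ≠ x := by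
    filter_upwards [Measure.ae_ne volume (0 : ℝ), Measure.ae_ne volume x] with t h1 h2
    exact ⟨h1, h2⟩
  filter_upwards [hae] with t ht
  simp only [Set.indicator, Set.mem_Ioc, sub_sub_cancel]
  by_cases h : 0 < t ∧ t < x
  · rw [if_pos ⟨by linarith, by linarith⟩, if_pos ⟨h.1, h.2.le⟩, mul_comm]
  · rw [if_neg, if_neg]
    · rintro ⟨h1, h2⟩
      exact h ⟨h1, lt_of_le_of_ne h2 ht.2⟩
    · rintro ⟨h1, h2⟩
      refine h ⟨?_, by linarith⟩
      rcases lt_or_eq_of_le h2 with h3 | h3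
      · linarith
      · exact absurd (by linarith : t = 0) ht.1

/-- The joint integrand `(x, t) ↦ 𝟙_{0 < t ≤ x} f(t) g(x − t)` is measurable. [folklore] -/
theorem measurable_integrand (hf : Measurable f) (hg : Measurable g) :
    Measurable (fun p : ℝ × ℝ => (Set.Ioc 0 p.1).indicator (fun t => f t * g (p.1 - t)) p.2) := by
  have h1 : Measurable fun p : ℝ × ℝ => f p.2 * g (p.1 - p.2) :=
    (hf.comp measurable_snd).mul (hg.comp (measurable_fst.sub measurable_snd))
  have hset : MeasurableSet {p : ℝ × ℝ | 0 < p.2 ∧ p.2 ≤ p.1} :=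
    (measurableSet_lt measurable_const measurable_snd).inter
      (measurableSet_le measurable_snd measurable_fst)
  have : (fun p : ℝ × ℝ => (Set.Ioc 0 p.1).indicator (fun t => f t * g (p.1 - t)) p.2) =
      {p : ℝ × ℝ | 0 < p.2 ∧ p.2 ≤ p.1}.indicator fun p => f p.2 * g (p.1 - p.2) := by
    funext p
    simp only [Set.indicator, Set.mem_Ioc, Set.mem_setOf_eq]
  rw [this]
  exact h1.indicator hset

/-- `f ⋆ g` is measurable for measurable `f, g`. [folklore] -/
theorem measurable_oconv (hf : Measurable f) (hg : Measurable g) : Measurable (oconv f g) := by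
  have hsm : StronglyMeasurable
      (Function.uncurry fun x t => (Set.Ioc 0 x).indicator (fun t => f t * g (x - t)) t) :=
    (measurable_integrand hf hg).stronglyMeasurable
  have := hsm.integral_prod_right (ν := (volume : Measure ℝ))
  have heq : oconv f g = fun x => ∫ t, (Set.Ioc 0 x).indicator (fun t => f t * g (x - t)) t := by
    funext x; exact oconv_eq_integral_indicator f g x
  rw [heq]
  exact this.measurable

/-- Pointwise bound `|(f ⋆ g)(x)| ≤ C D x` when `|f| ≤ C` and `|g| ≤ D` on `[-x, x]`. [folklore] -/
theorem abs_oconv_le {C D x : ℝ} (hx : 0 ≤ x) (hC : ∀ t, |t| ≤ x → |f t| ≤ C)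
    (hD : ∀ t, |t| ≤ x → |g t| ≤ D) (hC0 : 0 ≤ C) : |oconv f g x| ≤ C * D * x := by
  rw [oconv]
  have hbound : ∀ t ∈ Set.Ioc 0 x, ‖f t * g (x - t)‖ ≤ C * D := by
    intro t ht
    rw [Real.norm_eq_abs, abs_mul]
    refine mul_le_mul (hC t (abs_le.2 ⟨by linarith [ht.1], ht.2⟩))
      (hD (x - t) (abs_le.2 ⟨by linarith [ht.2], by linarith [ht.1]⟩)) (abs_nonneg _) hC0
  have h := norm_setIntegral_le_of_norm_le_const
    (measure_Ioc_lt_top : volume (Set.Ioc (0 : ℝ) x) < ⊤) hbound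
  rw [Real.norm_eq_abs, Measure.real, Real.volume_Ioc, ENNReal.toReal_ofReal (by linarith)] at h
  simpa [sub_zero, mul_comm] using h

/-- `f ⋆ g` is locally bounded and measurable if `f, g` are. [folklore] -/
theorem LocBdd.oconv (hf : LocBdd f) (hg : LocBdd g) : LocBdd (oconv f g) := by
  refine ⟨measurable_oconv hf.measurable hg.measurable, fun A => ?_⟩
  obtain ⟨C, hC0, hC⟩ := hf.bdd_nonneg A
  obtain ⟨D, hD0, hD⟩ := hg.bdd_nonneg A
  refine ⟨C * D * max A 0, fun x hx => ?_⟩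
  rcases le_or_gt x 0 with h | h
  · rw [oconv_of_nonpos h, abs_zero]; positivity
  · have hxA : x ≤ A := le_trans (le_abs_self x) hx
    calc |Literature.Analysis.Convolution.oconv f g x| ≤ C * D * x :=
          abs_oconv_le h.le (fun t ht => hC t (ht.trans hxA)) (fun t ht => hD t (ht.trans hxA)) hC0
      _ ≤ C * D * max A 0 :=
          mul_le_mul_of_nonneg_left (le_trans hxA (le_max_left _ _)) (mul_nonneg hC0 hD0)

/-- The convolution integrand is integrable on `(0, x]`. [folklore] -/
theorem integrableOn_integrand (hf : LocBdd f) (hg : LocBdd g) (x : ℝ) :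
    IntegrableOn (fun t => f t * g (x - t)) (Set.Ioc 0 x) := by
  obtain ⟨C, hC0, hC⟩ := hf.bdd_nonneg |x|
  obtain ⟨D, hD⟩ := hg.bdd |x|
  refine Measure.integrableOn_of_bounded (M := C * D) measure_Ioc_lt_top.ne
    ((hf.measurable.mul (hg.measurable.comp (measurable_const.sub measurable_id))).aestronglyMeasurable)
    ?_
  refine (ae_restrict_iff' measurableSet_Ioc).2 (Filter.Eventually.of_forall fun t ht => ?_)
  rw [Real.norm_eq_abs, abs_mul]
  have hx : 0 ≤ x := le_trans ht.1.le ht.2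
  refine mul_le_mul (hC t ?_) (hD (x - t) ?_) (abs_nonneg _) hC0
  · rw [abs_of_nonneg hx]; exact abs_le.2 ⟨by linarith [ht.1], ht.2⟩
  · rw [abs_of_nonneg hx]; exact abs_le.2 ⟨by linarith [ht.2], by linarith [ht.1]⟩

/-- Additivity in the first variable. [folklore] -/
theorem oconv_add_left (hf : LocBdd f) (hf' : LocBdd g) (hh : LocBdd h) :
    oconv (fun t => f t + g t) h = fun x => oconv f h x + oconv g h x := by
  funext x
  simp only [oconv, add_mul]
  exact integral_add (integrableOn_integrand hf hh x) (integrableOn_integrand hf' hh x)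

/-- Additivity in the second variable. [folklore] -/
theorem oconv_add_right (hf : LocBdd f) (hg : LocBdd g) (hh : LocBdd h) :
    oconv f (fun t => g t + h t) = fun x => oconv f g x + oconv f h x := by
  rw [oconv_comm, oconv_add_left hg hh hf, oconv_comm g f, oconv_comm h f]

/-- Homogeneity in the first variable. [folklore] -/
theorem oconv_const_mul_left (c : ℝ) (f g : ℝ → ℝ) :
    oconv (fun t => c * f t) g = fun x => c * oconv f g x := by
  funext x
  simp only [oconv, mul_assoc]
  exact integral_const_mul c _

/-- Homogeneity in the second variable. [folklore] -/
theorem oconv_const_mul_right (c : ℝ) (f g : ℝ → ℝ) :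
    oconv f (fun t => c * g t) = fun x => c * oconv f g x := by
  rw [oconv_comm, oconv_const_mul_left, oconv_comm g f]

/-- `0 ⋆ g = 0`. [folklore] -/
theorem oconv_zero_left (g : ℝ → ℝ) : oconv (fun _ => 0) g = fun _ => 0 := by
  funext x; simp [oconv]

/-- `f ⋆ 0 = 0`. [folklore] -/
theorem oconv_zero_right (f : ℝ → ℝ) : oconv f (fun _ => 0) = fun _ => 0 := by
  rw [oconv_comm, oconv_zero_left]

/-- Finite sums in the first variable. [folklore] -/
theorem oconv_sum_left {ι : Type*} (s : Finset ι) {F : ι → ℝ → ℝ} (hF : ∀ i ∈ s, LocBdd (F i))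
    (hg : LocBdd g) :
    oconv (fun t => ∑ i ∈ s, F i t) g = fun x => ∑ i ∈ s, oconv (F i) g x := by
  classical
  induction s using Finset.induction_on with
  | empty => simpa using oconv_zero_left g
  | insert a s ha ih =>
    have hFa : LocBdd (F a) := hF a (Finset.mem_insert_self a s)
    have hs : ∀ i ∈ s, LocBdd (F i) := fun i hi => hF i (Finset.mem_insert_of_mem hi)
    have hsum : LocBdd (fun t => ∑ i ∈ s, F i t) := LocBdd.sum s hs
    simp only [Finset.sum_insert ha]
    rw [oconv_add_left hFa hsum hg, ih hs]

/-- Finite sums in the second variable. [folklore] -/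
theorem oconv_sum_right {ι : Type*} (s : Finset ι) {F : ι → ℝ → ℝ} (hf : LocBdd f)
    (hF : ∀ i ∈ s, LocBdd (F i)) :
    oconv f (fun t => ∑ i ∈ s, F i t) = fun x => ∑ i ∈ s, oconv f (F i) x := by
  rw [oconv_comm, oconv_sum_left s hF hf]
  funext x
  exact Finset.sum_congr rfl fun i _ => by rw [oconv_comm]

end Basic

/-! ### Support, locality, the derivation `D f(t) = t f(t)` -/

section Support

variable {f g f' g' : ℝ → ℝ}

/-- **Locality**: the values of `f ⋆ g` on `(−∞, A]` only depend on the values of `f` and `g` on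
`[0, A]`. [folklore] -/
theorem oconv_congr_of_eqOn {A : ℝ} (hf : ∀ t ∈ Set.Icc 0 A, f t = f' t)
    (hg : ∀ t ∈ Set.Icc 0 A, g t = g' t) {x : ℝ} (hx : x ≤ A) :
    oconv f g x = oconv f' g' x := by
  rw [oconv, oconv]
  refine setIntegral_congr_fun measurableSet_Ioc fun t ht => ?_
  rw [hf t ⟨ht.1.le, ht.2.trans hx⟩, hg (x - t) ⟨by linarith [ht.2], by linarith [ht.1]⟩]

/-- Lower supports add: if `f = 0` on `(−∞, a)` and `g = 0` on `(−∞, b)` then `f ⋆ g = 0` on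
`(−∞, a + b)`. [folklore] -/
theorem oconv_eq_zero_of_lt {a b : ℝ} (hf : ∀ t, t < a → f t = 0) (hg : ∀ t, t < b → g t = 0) {x : ℝ}
    (hx : x < a + b) : oconv f g x = 0 := by
  rw [oconv]
  rw [setIntegral_congr_fun measurableSet_Ioc (g := fun _ => (0 : ℝ)) ?_, integral_zero]
  intro t _
  by_cases ht : t < a
  · simp [hf t ht]
  · have : x - t < b := by linarith [not_lt.1 ht]
    simp [hg _ this]

/-- Upper supports add: if `f = 0` on `[a, ∞)` and `g = 0` on `[b, ∞)` then `f ⋆ g = 0` on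
`[a + b, ∞)`. [folklore] -/
theorem oconv_eq_zero_of_le {a b : ℝ} (hf : ∀ t, a ≤ t → f t = 0) (hg : ∀ t, b ≤ t → g t = 0) {x : ℝ}
    (hx : a + b ≤ x) : oconv f g x = 0 := by
  rw [oconv]
  rw [setIntegral_congr_fun measurableSet_Ioc (g := fun _ => (0 : ℝ)) ?_, integral_zero]
  intro t _
  by_cases ht : a ≤ t
  · simp [hf t ht]
  · have : b ≤ x - t := by linarith [not_le.1 ht]
    simp [hg _ this]

/-- **`D(t) = t ·` is a derivation**: `x (f ⋆ g)(x) = ((t f) ⋆ g)(x) + (f ⋆ (t g))(x)`. [folklore] -/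
theorem id_mul_oconv (hf : LocBdd f) (hg : LocBdd g) (x : ℝ) :
    x * oconv f g x = oconv (fun t => t * f t) g x + oconv f (fun t => t * g t) x := by
  rw [oconv, oconv, oconv, ← integral_const_mul,
    ← integral_add (integrableOn_integrand hf.id_mul hg x) (integrableOn_integrand hf hg.id_mul x)]
  refine setIntegral_congr_fun measurableSet_Ioc fun t _ => ?_
  ring

end Support

/-! ### Fubini on the triangle `{0 < t ≤ s ≤ X}`; associativity -/

section Fubini

variable {f g h : ℝ → ℝ}

/-- **Fubini on a triangle**: for `K` measurable and bounded on `(0, X]²`,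
`∫_{0<s≤X} ∫_{0<t≤s} K(t,s) dt ds = ∫_{0<t≤X} ∫_{t<s≤X} K(t,s) ds dt`. [folklore] -/
theorem setIntegral_triangle_swap {X : ℝ} {K : ℝ → ℝ → ℝ}
    (hK : Measurable (Function.uncurry K)) {M : ℝ}
    (hM : ∀ t ∈ Set.Ioc 0 X, ∀ s ∈ Set.Ioc 0 X, |K t s| ≤ M) :
    ∫ s in Set.Ioc 0 X, ∫ t in Set.Ioc 0 s, K t s = ∫ t in Set.Ioc 0 X, ∫ s in Set.Ioc t X, K t s := by
  set μ : Measure ℝ := volume.restrict (Set.Ioc 0 X) with hμ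
  set F : ℝ → ℝ → ℝ := fun s t => if t ≤ s then K t s else 0 with hF
  haveI : IsFiniteMeasure μ := ⟨by
    rw [hμ, Measure.restrict_apply_univ]; exact measure_Ioc_lt_top⟩
  have hFm : Measurable (Function.uncurry F) := by
    have h1 : Measurable fun z : ℝ × ℝ => K z.2 z.1 := hK.comp measurable_swap
    have : Function.uncurry F = {z : ℝ × ℝ | z.2 ≤ z.1}.indicator fun z => K z.2 z.1 := by
      funext z; simp only [Function.uncurry, hF, Set.indicator, Set.mem_setOf_eq]
    rw [this]
    exact h1.indicator (measurableSet_le measurable_snd measurable_fst)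
  have hFi : Integrable (Function.uncurry F) (μ.prod μ) := by
    refine Integrable.of_bound hFm.aestronglyMeasurable (max M 0) ?_
    rw [Measure.ae_prod_iff_ae_ae]
    · rw [hμ, ae_restrict_iff' measurableSet_Ioc]
      refine Filter.Eventually.of_forall fun s hs => ?_
      rw [ae_restrict_iff' measurableSet_Ioc]
      refine Filter.Eventually.of_forall fun t ht => ?_
      simp only [Function.uncurry, hF]
      split_ifs
      · rw [Real.norm_eq_abs]; exact (hM t ht s hs).trans (le_max_left _ _)
      · simp
    · exact measurableSet_le hFm.norm.stronglyMeasurable.measurable measurable_const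
  have hswap := integral_integral_swap hFi
  have hL : ∫ s in Set.Ioc 0 X, ∫ t in Set.Ioc 0 s, K t s = ∫ s, ∫ t, F s t ∂μ ∂μ := by
    refine setIntegral_congr_fun measurableSet_Ioc fun s hs => ?_
    have h1 : (fun t => F s t) = (Set.Iic s).indicator fun t => K t s := by
      funext t; simp only [hF, Set.indicator, Set.mem_Iic]
    rw [h1, setIntegral_indicator measurableSet_Iic]
    congr 1
    congr 1
    ext t; simp only [Set.mem_inter_iff, Set.mem_Iic, Set.mem_Ioc]
    constructor
    · rintro ⟨h1, h2⟩; exact ⟨⟨h1, h2.trans hs.2⟩, h2⟩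
    · rintro ⟨⟨h1, _⟩, h3⟩; exact ⟨h1, h3⟩
  have hR : ∫ t in Set.Ioc 0 X, ∫ s in Set.Ioc t X, K t s = ∫ t, ∫ s, F s t ∂μ ∂μ := by
    refine setIntegral_congr_fun measurableSet_Ioc fun t ht => ?_
    have h1 : (fun s => F s t) = (Set.Ici t).indicator fun s => K t s := by
      funext s; simp only [hF, Set.indicator, Set.mem_Ici]
    rw [h1, setIntegral_indicator measurableSet_Ici]
    -- `Ioc 0 X ∩ Ici t = Icc t X` and `Ioc t X` differ by the null set `{t}`
    have hset : Set.Ioc 0 X ∩ Set.Ici t = Set.Icc t X := by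
      ext s; simp only [Set.mem_inter_iff, Set.mem_Ici, Set.mem_Ioc, Set.mem_Icc]
      constructor
      · rintro ⟨⟨_, h2⟩, h3⟩; exact ⟨h3, h2⟩
      · rintro ⟨h1, h2⟩; exact ⟨⟨ht.1.trans_le h1, h2⟩, h1⟩
    rw [hset]
    exact setIntegral_congr_set Ioc_ae_eq_Icc
  rw [hL, hR, hswap]

/-- Translation: `∫_{t < s ≤ x} φ(s − t) ds = ∫_{0 < u ≤ x − t} φ(u) du`. [folklore] -/
theorem setIntegral_Ioc_comp_sub (φ : ℝ → ℝ) {t x : ℝ} (htx : t ≤ x) :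
    ∫ s in Set.Ioc t x, φ (s - t) = ∫ u in Set.Ioc 0 (x - t), φ u := by
  rw [← intervalIntegral.integral_of_le htx, ← intervalIntegral.integral_of_le (by linarith),
    intervalIntegral.integral_comp_sub_right, sub_self]

/-- A bound for the triple-product kernel on `(0, x]²`. [folklore] -/
theorem exists_bound_kernel (hf : LocBdd f) (hg : LocBdd g) (hh : LocBdd h) (x : ℝ) :
    ∃ M, ∀ t ∈ Set.Ioc 0 x, ∀ s ∈ Set.Ioc 0 x, |f t * g (s - t) * h (x - s)| ≤ M := by
  obtain ⟨C, hC0, hC⟩ := hf.bdd_nonneg |x|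
  obtain ⟨D, hD0, hD⟩ := hg.bdd_nonneg |x|
  obtain ⟨E, hE⟩ := hh.bdd |x|
  refine ⟨C * D * E, fun t ht s hs => ?_⟩
  have hx : 0 ≤ x := ht.1.le.trans ht.2
  rw [abs_mul, abs_mul]
  refine mul_le_mul (mul_le_mul (hC t ?_) (hD _ ?_) (abs_nonneg _) hC0) (hE _ ?_) (abs_nonneg _)
    (mul_nonneg hC0 hD0)
  · rw [abs_of_nonneg hx]; exact abs_le.2 ⟨by linarith [ht.1], ht.2⟩
  · rw [abs_of_nonneg hx]
    exact abs_le.2 ⟨by linarith [hs.1, hs.2, ht.1, ht.2], by linarith [hs.1, hs.2, ht.1, ht.2]⟩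
  · rw [abs_of_nonneg hx]
    exact abs_le.2 ⟨by linarith [hs.1, hs.2], by linarith [hs.1, hs.2]⟩

/-- **Associativity**: `(f ⋆ g) ⋆ h = f ⋆ (g ⋆ h)`. [folklore] -/
theorem oconv_assoc (hf : LocBdd f) (hg : LocBdd g) (hh : LocBdd h) :
    oconv (oconv f g) h = oconv f (oconv g h) := by
  funext x
  -- left side as an iterated integral over the triangle
  have hL : oconv (oconv f g) h x =
      ∫ s in Set.Ioc 0 x, ∫ t in Set.Ioc 0 s, f t * g (s - t) * h (x - s) := by
    rw [oconv]
    refine setIntegral_congr_fun measurableSet_Ioc fun s _ => ?_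
    rw [oconv, ← integral_mul_const]
  obtain ⟨M, hM⟩ := exists_bound_kernel hf hg hh x
  have hK : Measurable (Function.uncurry fun t s => f t * g (s - t) * h (x - s)) :=
    ((hf.measurable.comp measurable_fst).mul
      (hg.measurable.comp (measurable_snd.sub measurable_fst))).mul
      (hh.measurable.comp (measurable_const.sub measurable_snd))
  rw [hL, setIntegral_triangle_swap hK hM, oconv]
  refine setIntegral_congr_fun measurableSet_Ioc fun t ht => ?_
  rw [oconv]
  have h1 : ∫ s in Set.Ioc t x, f t * g (s - t) * h (x - s) =
      f t * ∫ s in Set.Ioc t x, (fun u => g u * h (x - t - u)) (s - t) := by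
    rw [← integral_const_mul]
    refine setIntegral_congr_fun measurableSet_Ioc fun s _ => ?_
    simp only [mul_assoc]
    congr 2
    ring_nf
  rw [h1]
  congr 1
  exact setIntegral_Ioc_comp_sub (fun u => g u * h (x - t - u)) ht.2

/-- **Integral of a convolution**: `∫_{0<x≤X} (g ⋆ h)(x) dx = ∫_{0<t≤X} g(t) (∫_{0<u≤X−t} h(u) du) dt`.
[folklore] -/
theorem setIntegral_oconv (hg : LocBdd g) (hh : LocBdd h) (X : ℝ) :
    ∫ x in Set.Ioc 0 X, oconv g h x =
      ∫ t in Set.Ioc 0 X, g t * ∫ u in Set.Ioc 0 (X - t), h u := by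
  obtain ⟨M, hM⟩ := exists_bound_kernel hg hh (LocBdd.const 1) X
  have hK : Measurable (Function.uncurry fun t x => g t * h (x - t)) :=
    (hg.measurable.comp measurable_fst).mul (hh.measurable.comp (measurable_snd.sub measurable_fst))
  have hM' : ∀ t ∈ Set.Ioc 0 X, ∀ x ∈ Set.Ioc 0 X, |g t * h (x - t)| ≤ M := by
    intro t ht x hx
    simpa using hM t ht x hx
  simp only [oconv]
  rw [setIntegral_triangle_swap hK hM']
  refine setIntegral_congr_fun measurableSet_Ioc fun t ht => ?_
  rw [integral_const_mul, setIntegral_Ioc_comp_sub _ ht.2]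

end Fubini

/-! ### Positivity and Young-type bounds -/

section Bounds

variable {f g h f' : ℝ → ℝ}

/-- `f, g ≥ 0 ⟹ f ⋆ g ≥ 0`. [folklore] -/
theorem oconv_nonneg (hf : ∀ t, 0 ≤ f t) (hg : ∀ t, 0 ≤ g t) (x : ℝ) : 0 ≤ oconv f g x :=
  setIntegral_nonneg measurableSet_Ioc fun t _ => mul_nonneg (hf t) (hg _)

/-- Monotonicity in the first variable against a non-negative second variable. [folklore] -/
theorem oconv_mono_left (hf : LocBdd f) (hf' : LocBdd f') (hg : LocBdd g) (hle : ∀ t, f t ≤ f' t)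
    (hg0 : ∀ t, 0 ≤ g t) (x : ℝ) : oconv f g x ≤ oconv f' g x :=
  setIntegral_mono_on (integrableOn_integrand hf hg x) (integrableOn_integrand hf' hg x)
    measurableSet_Ioc fun t _ => mul_le_mul_of_nonneg_right (hle t) (hg0 _)

/-- Monotonicity in the second variable against a non-negative first variable. [folklore] -/
theorem oconv_mono_right (hf : LocBdd f) (hg : LocBdd g) (hf' : LocBdd f') (hle : ∀ t, g t ≤ f' t)
    (hf0 : ∀ t, 0 ≤ f t) (x : ℝ) : oconv f g x ≤ oconv f f' x := by
  rw [oconv_comm f g, oconv_comm f f']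
  exact oconv_mono_left hg hf' hf hle hf0 x

/-- **Young, `sup × L¹`**: if `f ≤ S` everywhere and `g ≥ 0` then
`(f ⋆ g)(x) ≤ S ∫_{0<t≤x} g`. [folklore] -/
theorem oconv_le_mul_setIntegral (hf : LocBdd f) (hg : LocBdd g) {S : ℝ} (hS : ∀ t, f t ≤ S)
    (hg0 : ∀ t, 0 ≤ g t) (x : ℝ) : oconv f g x ≤ S * ∫ t in Set.Ioc 0 x, g t := by
  rw [oconv_comm, oconv, ← integral_const_mul]
  refine setIntegral_mono_on (integrableOn_integrand hg hf x)
    ((hg.integrableOn_Ioc 0 x).const_mul S) measurableSet_Ioc fun t _ => ?_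
  rw [mul_comm S]
  exact mul_le_mul_of_nonneg_left (hS _) (hg0 t)

/-- **Young, `L¹ × L¹`** for non-negative functions:
`∫_{0<x≤X} (g ⋆ h) ≤ (∫_{0<t≤X} g) (∫_{0<u≤X} h)`. [folklore] -/
theorem setIntegral_oconv_le (hg : LocBdd g) (hh : LocBdd h) (hg0 : ∀ t, 0 ≤ g t)
    (hh0 : ∀ t, 0 ≤ h t) (X : ℝ) :
    ∫ x in Set.Ioc 0 X, oconv g h x ≤ (∫ t in Set.Ioc 0 X, g t) * ∫ u in Set.Ioc 0 X, h u := by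
  rw [setIntegral_oconv hg hh X, ← integral_mul_const]
  refine setIntegral_mono_on ?_ ((hg.integrableOn_Ioc 0 X).mul_const _) measurableSet_Ioc
    fun t ht => ?_
  · -- integrability of `t ↦ g t * ∫_0^{X-t} h`: bounded measurable on a finite interval
    have hm : LocBdd (fun t => ∫ u in Set.Ioc 0 (X - t), h u) := by
      have h1 : (fun t => ∫ u in Set.Ioc 0 (X - t), h u) = fun t => oconv h (fun _ => 1) (X - t) := by
        funext t; simp [oconv]
      rw [h1]
      have h2 := hh.oconv (LocBdd.const 1)
      refine ⟨h2.measurable.comp (measurable_const.sub measurable_id), fun A => ?_⟩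
      obtain ⟨C, hC⟩ := h2.bdd (|X| + A)
      exact ⟨C, fun t ht => hC _ ((abs_sub _ _).trans (by linarith))⟩
    exact (hg.mul hm).integrableOn_Ioc 0 X
  · refine mul_le_mul_of_nonneg_left ?_ (hg0 t)
    exact setIntegral_mono_set (hh.integrableOn_Ioc 0 X)
      (Filter.Eventually.of_forall fun u => hh0 u)
      (Filter.Eventually.of_forall (Set.Ioc_subset_Ioc_right (by linarith [ht.1])))

end Bounds

end Literature.Analysis.Convolution
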